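import Summits.QuantumFields.YangMills.Theorems.BalabanUVNodesN19NoLinearPrice
import Mathlib.Algebra.Group.ForwardDiff
import Mathlib.Data.Nat.Choose.Sum
import Mathlib.Analysis.SpecialFunctions.Trigonometric.Deriv
import Mathlib.Analysis.SpecialFunctions.Log.PosLog

/-!
# YM-DAG node N19 (= NE7 proper) — THE LAW-LEVEL PRICE IS LOGARITHMIC, I: the binomial witness

Cell `pub-ymgap`, HUMAN RULING D-0062 (Track A), R141 (C) wider-strategy seat `pub-ymgap-dag-n19-e` (strategy s3 = ALTERNATIVE CURRENCY), generation
g17, module 1.  Route `Summits/QuantumFields/YangMills/Theses/BalabanUVNodes.lean` rev 25, cluster item K3⁷ «SpineGivenEndpointR13SepCoPH»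
(stmt-QuantumFields-20544, dag-lead WORDS-143); filed `--supports` that item `--as helper` (it proves no registered stub).  COUNT-NEUTRAL: elementary combinatorics ∕
real analysis ∕ probability over Mathlib (`add_pow`, `Nat.sum_range_choose`, `fwdDiff_iter_eq_sum_shift` ∕ `fwdDiff_iter_pow_eq_zero_of_lt`,
`lipschitzWith_of_nnnorm_deriv_le`, `Measure.dirac`) + the seat's p510514 `…N19NoLinearPrice` BY NAME (`exists_lawPair_of_weights`,
`abs_expm1_ratio_le_one`, `abs_log_sub_log_le`, `exp_neg_le_mgf_of_Icc`); no scheme object, no Theses import; NOT a discharge claim.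

THE QUESTION.  The seat's currency story prices what N19's DECL target (`T4CauchySum.MatchingModConstants` ∕ `Spine.NE7.Target`: cgf's of a
bounded observable `ε`-close on a real window `|t| ≤ l₀`) buys: EXPECTATIONS at `P(ε) = ε(1+L)∕log(e+L)`, `L = log⁺ε⁻¹` (p516009 ∕ p517472,
two-sided), TILTED MEANS at `P(ε)∕√(l₀²−s²)` inside and `P₂(ε)` at the edge (p528923 ∕ p530176 ∕ p539220, two-sided), the cgf OFF the window at
`ε^{1−Θ(arcosh(|t|∕l₀)∕log log ε⁻¹)}` (p521610 ∕ p524926), and the LAW itself: under `Target` the law of the observable converges weakly to a continuum law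
(p504707 ∕ p505344 `exists_continuumLaw_of_target`) — with NO rate.  What rate CAN the law have?  For a Lipschitz test function `g` that is NOT an
exponential `e^{tx}` (not analytic at all), how small is `|∫ g dν − ∫ g dμ|` when the cgf's are `ε`-close on the window?

THE ANSWER, LOWER HALF (this module; the upper half `√(log(e+L)∕(1+L))` via Bernstein polynomials is the business of a sibling to follow).  ONLY
LOGARITHMIC: the bounded-Lipschitz (a fortiori Wasserstein-1) price of window matching is `≳ log L ∕ L` — worse than ANY power `ε^a` and worse than
`1∕log ε⁻¹`.  THE BINOMIAL WITNESS (§1): on the grid `{k∕n} ⊂ [0,1]` the weights `w_k = 2^{1−n}·(−1)^{n−k}·C(n,k)` have `∑ w_k = 0`, `∑ |w_k| = 2`,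
exponential sums `∑_k w_k e^{tk∕n} = 2^{1−n}·(e^{t∕n} − 1)^n` (the binomial theorem) of modulus `≤ ε := 2^{1−n}(e^{l₀∕n} − 1)^n ≤ 2·(l₀e^{l₀}∕(2n))^n`
on `|t| ≤ l₀` (super-exponentially small: `log ε⁻¹ ≍ n log n`), ALL MOMENTS OF ORDER `< n` VANISH (`∑_k w_k (k∕n)^j = 0`, `j < n`: the `n`-th forward
difference kills polynomials of degree `< n` — Mathlib `fwdDiff_iter_pow_eq_zero_of_lt`), and yet the `1`-Lipschitz test function
`g_n(x) = (1 − cos(πnx))∕(πn) ∈ [0, 2∕(πn)]` (§2; `g_n(k∕n) = (1 − (−1)^k)∕(πn)`) is paid `∑_k w_k g_n(k∕n) = −(−1)^n·2∕(πn)` EXACTLY (§1).  §3 realises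
`w` as `ν − μ` for two probability laws on `[0,1]` (p510514 `exists_lawPair_of_weights`): ★★ `exists_cgf_close_laws_far` — mgf's `ε`-close and cgf's
`e^{l₀}ε`-close on the window, moments `< n` equal, `|∫ g_n dν − ∫ g_n dμ| = 2∕(πn)`.  §4 in `ε`-language: ★★ `law_price_not_inverse_log` — for every
`C` and `ε₀` a pair with cgf's `ε`-close, `ε ≤ ε₀`, and a `1`-Lipschitz `[0,1]`-valued `g` with `|∫ g dν − ∫ g dμ| > C∕(1 + log⁺ε⁻¹)` (so NO estimate
`dist_BL(μ,ν) ≤ C(l₀)∕log ε⁻¹`, let alone `C(l₀)·ε^a` or `C(l₀)·P(ε)`, follows from window matching; NOT CLAIMED here: the matching upper bound —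
Bernstein-polynomial approximation gives `C(l₀)·√(log(e+L)∕(1+L))`, Jackson's theorem would give `C(l₀)·log(e+L)∕(1+L)`; neither is typed in this module).

WHY IT MATTERS FOR THE NODE (honest).  N19's target delivers, per string of observables, matching of cgf's on a window with summable remainders;
the apex consumes expectations (served at `P`), N14's binder tilted means (served at `P∕√`), and g9 typed the continuum LAW.  This module says the law
is the WEAKEST currency: even with geometric remainders `δ_K ≍ θ^K` (`L_K ≍ K`) no law-level distance better than `O(log K ∕ K)` can be certified from
the window (here, at `n ≍ K∕log K`) — and matching finitely many moments on top does not help (they all agree here).  [folklore: the `n`-th difference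
functional ∕ Favard–Jackson duality; the witness is the signed binomial measure.]

HONEST FRAMING (binding).  Elementary and [folklore]; NO consumer in the DAG today; the value is an optimality statement about the seat's own currency
(what g9's continuum law can be asked to carry).  Nothing of Bałaban's is instantiated; NE7 ∕ NE7b ∕ NE7c NOT PRINTED, NOT proved; N19 NOT discharged;
count-neutral.  One finite `T⁴` programme at fixed `ε`; nothing continuum ∕ `ℝ⁴` ∕ OS ∕ mass-gap ∕ Clay.  0 `def` ∕ 0 `sorry`.
-/

noncomputable section

open Real Finset MeasureTheory ProbabilityTheory

namespace Summit.QuantumFields.YangMills.Theorems.BalabanUVNodesN19LawPrice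

open Summit.QuantumFields.YangMills.Theorems.BalabanUVNodesN19NoLinearPrice
  (exists_lawPair_of_weights abs_expm1_ratio_le_one abs_log_sub_log_le exp_neg_le_mgf_of_Icc)

/-! ## §1 The signed binomial weights on the grid `{k∕n}` [folklore] -/

/-- The `n`-th difference kills monomials of degree `< n`: `∑_{k ≤ n} (−1)^{n−k} C(n,k) k^j = 0` for `j < n`
(Mathlib `fwdDiff_iter_eq_sum_shift` + `fwdDiff_iter_pow_eq_zero_of_lt` at step `1`, base point `0`). [folklore] -/
theorem sum_negOnePow_mul_choose_mul_pow_eq_zero {j n : ℕ} (h : j < n) :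
    ∑ k ∈ range (n + 1), (-1 : ℝ) ^ (n - k) * (n.choose k : ℝ) * (k : ℝ) ^ j = 0 := by
  have h1 := fwdDiff_iter_eq_sum_shift (h := (1 : ℝ)) (fun r : ℝ => r ^ j) n 0
  rw [fwdDiff_iter_pow_eq_zero_of_lt h] at h1
  simp only [Pi.zero_apply, zero_add, nsmul_eq_mul, mul_one, zsmul_eq_mul, Int.cast_mul, Int.cast_pow,
    Int.cast_neg, Int.cast_one, Int.cast_natCast] at h1
  exact h1.symm

/-- The binomial theorem on the grid: `∑_{k ≤ n} (−1)^{n−k} C(n,k) u^k = (u − 1)^n`. [folklore] -/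
theorem sum_negOnePow_mul_choose_mul_pow (n : ℕ) (u : ℝ) :
    ∑ k ∈ range (n + 1), (-1 : ℝ) ^ (n - k) * (n.choose k : ℝ) * u ^ k = (u - 1) ^ n := by
  rw [sub_eq_add_neg, add_pow]
  exact sum_congr rfl fun k _ => by ring

/-- **THE BINOMIAL WITNESS.**  For every window `0 < l₀` and every `n ≥ 1`: the weights `w_k = 2^{1−n}(−1)^{n−k}C(n,k)` on `{0,…,n}` have
`∑ w_k = 0`, `∑ |w_k| = 2`; with `ε := 2^{1−n}(e^{l₀∕n} − 1)^n` (`2(l₀∕(2n))^n ≤ ε ≤ 2(l₀e^{l₀}∕(2n))^n`) the exponential sum `∑_k w_k e^{tk∕n}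
= 2^{1−n}(e^{t∕n} − 1)^n` has modulus `≤ ε` on `|t| ≤ l₀` and EQUALS `ε` at `t = l₀`; every moment of order `j < n` vanishes; and the grid values
`(1 − (−1)^k)∕(πn)` of §2's test function are paid `−(−1)^n·2∕(πn)`. [folklore] -/
theorem exists_binomial_witness {l₀ : ℝ} (hl₀ : 0 < l₀) {n : ℕ} (hn : 0 < n) :
    ∃ (w : ℕ → ℝ) (ε : ℝ), 0 < ε ∧
      ∑ k ∈ range (n + 1), w k = 0 ∧ ∑ k ∈ range (n + 1), |w k| = 2 ∧
      2 * (l₀ / (2 * n)) ^ n ≤ ε ∧ ε ≤ 2 * (l₀ * exp l₀ / (2 * n)) ^ n ∧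
      (∀ t : ℝ, |t| ≤ l₀ → |∑ k ∈ range (n + 1), w k * exp (t * k / n)| ≤ ε) ∧
      ∑ k ∈ range (n + 1), w k * exp (l₀ * k / n) = ε ∧
      (∀ j : ℕ, j < n → ∑ k ∈ range (n + 1), w k * ((k : ℝ) / n) ^ j = 0) ∧
      ∑ k ∈ range (n + 1), w k * ((1 - (-1 : ℝ) ^ k) / (π * n)) = -(-1 : ℝ) ^ n * (2 / (π * n)) := by
  have hnr : (0 : ℝ) < n := Nat.cast_pos.mpr hn
  have hn1 : (1 : ℝ) ≤ n := by exact_mod_cast hn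
  set a : ℝ := l₀ / n with ha_def
  have ha0 : 0 < a := div_pos hl₀ hnr
  set r : ℝ := exp (l₀ / n) - 1 with hr_def
  have hra : a ≤ r := by
    have := Real.add_one_le_exp (l₀ / n)
    rw [hr_def]
    linarith
  have hr0 : 0 < r := lt_of_lt_of_le ha0 hra
  have hr_le : r ≤ l₀ * exp l₀ / n := by
    calc r ≤ l₀ / n * exp (l₀ / n) := Literature.Analysis.ODE.exp_sub_one_le_mul_exp _
      _ ≤ l₀ / n * exp l₀ := mul_le_mul_of_nonneg_left (exp_le_exp.mpr (div_le_self hl₀.le hn1)) ha0.le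
      _ = l₀ * exp l₀ / n := by ring
  -- the normalising constant `c = 2∕2^n`
  set c : ℝ := 2 / 2 ^ n with hc_def
  have hc0 : 0 < c := by positivity
  have hc2 : c * 2 ^ n = 2 := by rw [hc_def, div_mul_cancel₀ _ (by positivity)]
  -- the weights and their factorisation
  set w : ℕ → ℝ := fun k => c * ((-1 : ℝ) ^ (n - k) * (n.choose k : ℝ)) with hw_def
  have hsum : ∀ g : ℕ → ℝ, ∑ k ∈ range (n + 1), w k * g k =
      c * ∑ k ∈ range (n + 1), (-1 : ℝ) ^ (n - k) * (n.choose k : ℝ) * g k := by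
    intro g
    rw [mul_sum]
    exact sum_congr rfl fun k _ => by simp only [hw_def]; ring
  have hexp : ∀ t : ℝ, ∑ k ∈ range (n + 1), w k * exp (t * k / n) = c * (exp (t / n) - 1) ^ n := by
    intro t
    rw [hsum, ← sum_negOnePow_mul_choose_mul_pow n (exp (t / n))]
    refine congrArg (c * ·) (sum_congr rfl fun k _ => ?_)
    rw [← Real.exp_nat_mul]
    congr 2
    ring
  have hchoose : ∑ k ∈ range (n + 1), (n.choose k : ℝ) = 2 ^ n := by
    exact_mod_cast Nat.sum_range_choose n
  refine ⟨w, c * r ^ n, by positivity, ?_, ?_, ?_, ?_, ?_, ?_, ?_, ?_⟩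
  · -- equal mass: `(1 − 1)^n = 0`
    have h := hsum fun _ => 1
    simp only [mul_one] at h
    rw [h]
    have : ∑ k ∈ range (n + 1), (-1 : ℝ) ^ (n - k) * (n.choose k : ℝ) = (1 - 1) ^ n := by
      rw [← sum_negOnePow_mul_choose_mul_pow n 1]
      simp only [one_pow, mul_one]
    rw [this, sub_self, zero_pow hn.ne', mul_zero]
  · -- total variation `2`
    have : ∀ k, |w k| = c * (n.choose k : ℝ) := fun k => by
      simp only [hw_def, abs_mul, abs_of_pos hc0, abs_pow, abs_neg, abs_one, one_pow, one_mul, Nat.abs_cast]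
    simp_rw [this]
    rw [← mul_sum, hchoose, hc2]
  · -- `ε` from below
    rw [show 2 * (l₀ / (2 * n)) ^ n = c * a ^ n by
      rw [hc_def, ha_def, div_mul_eq_div_div, div_pow, div_pow]; ring]
    exact mul_le_mul_of_nonneg_left (pow_le_pow_left₀ ha0.le hra n) hc0.le
  · -- `ε` from above
    rw [show 2 * (l₀ * exp l₀ / (2 * n)) ^ n = c * (l₀ * exp l₀ / n) ^ n by
      rw [hc_def, div_mul_eq_div_div_swap, div_pow, div_pow]; ring]
    exact mul_le_mul_of_nonneg_left (pow_le_pow_left₀ hr0.le hr_le n) hc0.le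
  · -- the window bound
    intro t ht
    rw [hexp t, abs_mul, abs_of_pos hc0, abs_pow]
    refine mul_le_mul_of_nonneg_left (pow_le_pow_left₀ (abs_nonneg _) ?_ n) hc0.le
    have h1 := abs_expm1_ratio_le_one hl₀ hn ht
    rw [abs_mul, abs_inv, abs_of_pos hr0, inv_mul_le_iff₀ hr0, mul_one] at h1
    exact h1
  · -- equality at `t = l₀`
    rw [hexp l₀]
  · -- vanishing moments of order `< n`
    intro j hj
    have h := hsum fun k => ((k : ℝ) / n) ^ j
    rw [h]
    have : ∑ k ∈ range (n + 1), (-1 : ℝ) ^ (n - k) * (n.choose k : ℝ) * ((k : ℝ) / n) ^ j =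
        (1 / (n : ℝ) ^ j) * ∑ k ∈ range (n + 1), (-1 : ℝ) ^ (n - k) * (n.choose k : ℝ) * (k : ℝ) ^ j := by
      rw [mul_sum]
      exact sum_congr rfl fun k _ => by rw [div_pow]; ring
    rw [this, sum_negOnePow_mul_choose_mul_pow_eq_zero hj, mul_zero, mul_zero]
  · -- the grid values of the test function
    have h := hsum fun k => (1 - (-1 : ℝ) ^ k) / (π * n)
    rw [h]
    have hk : ∀ k ∈ range (n + 1), (-1 : ℝ) ^ (n - k) * (n.choose k : ℝ) * ((1 - (-1 : ℝ) ^ k) / (π * n)) =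
        (1 / (π * n)) * ((-1 : ℝ) ^ (n - k) * (n.choose k : ℝ)) - ((-1 : ℝ) ^ n / (π * n)) * (n.choose k : ℝ) := by
      intro k hk
      have hkn : k ≤ n := Nat.lt_succ_iff.mp (mem_range.mp hk)
      have hpow : (-1 : ℝ) ^ (n - k) * (-1) ^ k = (-1) ^ n := by
        rw [← pow_add, Nat.sub_add_cancel hkn]
      calc (-1 : ℝ) ^ (n - k) * (n.choose k : ℝ) * ((1 - (-1 : ℝ) ^ k) / (π * n))
          = (1 / (π * n)) * ((-1 : ℝ) ^ (n - k) * (n.choose k : ℝ))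
              - (1 / (π * n)) * ((-1 : ℝ) ^ (n - k) * (-1) ^ k) * (n.choose k : ℝ) := by ring
        _ = _ := by rw [hpow]; ring
    rw [sum_congr rfl hk, sum_sub_distrib, ← mul_sum, ← mul_sum, hchoose]
    have h0 : ∑ k ∈ range (n + 1), (-1 : ℝ) ^ (n - k) * (n.choose k : ℝ) = 0 := by
      have := sum_negOnePow_mul_choose_mul_pow n 1
      simp only [one_pow, mul_one, sub_self, zero_pow hn.ne'] at this
      exact this
    rw [h0, mul_zero, zero_sub, hc_def]
    field_simp

/-! ## §2 The test function `g_n(x) = (1 − cos(πnx))∕(πn)` (displayed, never named) [folklore] -/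

/-- `g_n′(x) = sin(πnx)`. [folklore] -/
theorem hasDerivAt_cosWave {n : ℕ} (hn : 0 < n) (x : ℝ) :
    HasDerivAt (fun x : ℝ => (1 - cos (π * n * x)) / (π * n)) (sin (π * n * x)) x := by
  have hpn : (π * n : ℝ) ≠ 0 := by positivity
  have h1 : HasDerivAt (fun x : ℝ => π * n * x) (π * n) x := by
    simpa using (hasDerivAt_id x).const_mul (π * n)
  have h2 : HasDerivAt (fun x : ℝ => cos (π * n * x)) (-sin (π * n * x) * (π * n)) x :=
    (Real.hasDerivAt_cos _).comp x h1
  have h3 := (h2.const_sub 1).div_const (π * n)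
  rwa [neg_mul, neg_neg, mul_div_cancel_right₀ _ hpn] at h3

/-- `g_n` is `1`-Lipschitz on `ℝ`. [folklore] -/
theorem lipschitzWith_one_cosWave {n : ℕ} (hn : 0 < n) :
    LipschitzWith 1 (fun x : ℝ => (1 - cos (π * n * x)) / (π * n)) := by
  refine lipschitzWith_of_nnnorm_deriv_le (fun x => (hasDerivAt_cosWave hn x).differentiableAt) fun x => ?_
  rw [(hasDerivAt_cosWave hn x).deriv, ← NNReal.coe_le_coe, coe_nnnorm, NNReal.coe_one, Real.norm_eq_abs]
  exact abs_sin_le_one _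

/-- `0 ≤ g_n`. [folklore] -/
theorem cosWave_nonneg (n : ℕ) (x : ℝ) : 0 ≤ (1 - cos (π * n * x)) / (π * n) := by
  rcases Nat.eq_zero_or_pos n with rfl | hn
  · simp
  · exact div_nonneg (by linarith [cos_le_one (π * n * x)]) (by positivity)

/-- `g_n ≤ 2∕(πn)`. [folklore] -/
theorem cosWave_le (n : ℕ) (x : ℝ) : (1 - cos (π * n * x)) / (π * n) ≤ 2 / (π * n) := by
  rcases Nat.eq_zero_or_pos n with rfl | hn
  · simp
  · exact div_le_div_of_nonneg_right (by linarith [neg_one_le_cos (π * n * x)]) (by positivity)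

/-- On the grid: `g_n(k∕n) = (1 − (−1)^k)∕(πn)` (Mathlib `cos_nat_mul_pi`). [folklore] -/
theorem cosWave_grid {n : ℕ} (hn : 0 < n) (k : ℕ) :
    (1 - cos (π * n * ((k : ℝ) / n))) / (π * n) = (1 - (-1 : ℝ) ^ k) / (π * n) := by
  have hnr : (n : ℝ) ≠ 0 := by exact_mod_cast hn.ne'
  rw [show π * n * ((k : ℝ) / n) = k * π by field_simp, cos_nat_mul_pi]

/-! ## §3 Two probability laws on `[0, 1]`: generating functions close on the window, all low moments equal, laws far -/

/-- **★★ CGF's CLOSE ON THE WINDOW, MOMENTS `< n` EQUAL, LAWS `2∕(πn)` APART IN THE BOUNDED-LIPSCHITZ METRIC.**  For every window `0 < l₀` and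
every `n ≥ 1`: two probability laws `μ, ν` on `[0, 1]` (§1's binomial weights through p510514's `exists_lawPair_of_weights`) and `ε` with
`2(l₀∕(2n))^n ≤ ε ≤ 2(l₀e^{l₀}∕(2n))^n` such that `|mgf_ν(t) − mgf_μ(t)| ≤ ε` on `|t| ≤ l₀` (equality of modulus at `t = l₀`), `|cgf_ν(t) − cgf_μ(t)| ≤ e^{l₀}ε`
there, `∫ x^j dν = ∫ x^j dμ` for every `j < n`, and `|∫ g_n dν − ∫ g_n dμ| = 2∕(πn)` for the `1`-Lipschitz, `[0, 2∕(πn)]`-valued test function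
`g_n(x) = (1 − cos(πnx))∕(πn)` of §2. [folklore] -/
theorem exists_cgf_close_laws_far {l₀ : ℝ} (hl₀ : 0 < l₀) {n : ℕ} (hn : 0 < n) :
    ∃ μ ν : Measure ℝ, IsProbabilityMeasure μ ∧ IsProbabilityMeasure ν ∧
      μ (Set.Icc 0 1)ᶜ = 0 ∧ ν (Set.Icc 0 1)ᶜ = 0 ∧
      ∃ ε : ℝ, 0 < ε ∧ 2 * (l₀ / (2 * n)) ^ n ≤ ε ∧ ε ≤ 2 * (l₀ * exp l₀ / (2 * n)) ^ n ∧
        (∀ t : ℝ, |t| ≤ l₀ → |mgf id ν t - mgf id μ t| ≤ ε) ∧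
        |mgf id ν l₀ - mgf id μ l₀| = ε ∧
        (∀ t : ℝ, |t| ≤ l₀ → |cgf id ν t - cgf id μ t| ≤ exp l₀ * ε) ∧
        (∀ j : ℕ, j < n → ∫ x, x ^ j ∂ν = ∫ x, x ^ j ∂μ) ∧
        |∫ x, (1 - cos (π * n * x)) / (π * n) ∂ν - ∫ x, (1 - cos (π * n * x)) / (π * n) ∂μ| = 2 / (π * n) := by
  obtain ⟨w, ε, hε, h0, h2, hlo, hhi, hwin, hat, hmom, htest⟩ := exists_binomial_witness hl₀ hn
  obtain ⟨μ, ν, iμ, iν, hμ, hν, hg⟩ := exists_lawPair_of_weights w h0 h2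
  have hmgf : ∀ t : ℝ, mgf id ν t - mgf id μ t = ∑ k ∈ range (n + 1), w k * exp (t * k / n) := by
    intro t
    simp only [mgf, id]
    rw [hg fun x => exp (t * x)]
    refine sum_congr rfl fun k _ => ?_
    rw [mul_div_assoc]
  refine ⟨μ, ν, iμ, iν, hμ, hν, ε, hε, hlo, hhi, fun t ht => ?_, ?_, fun t ht => ?_, fun j hj => ?_, ?_⟩
  · rw [hmgf]
    exact hwin t ht
  · rw [hmgf, hat, abs_of_pos hε]
  · have hm : 0 < exp (-l₀) := exp_pos _
    calc |cgf id ν t - cgf id μ t| ≤ |mgf id ν t - mgf id μ t| / exp (-l₀) :=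
          abs_log_sub_log_le hm (exp_neg_le_mgf_of_Icc hν ht) (exp_neg_le_mgf_of_Icc hμ ht)
      _ ≤ ε / exp (-l₀) := div_le_div_of_nonneg_right (by rw [hmgf]; exact hwin t ht) hm.le
      _ = exp l₀ * ε := by rw [Real.exp_neg, div_inv_eq_mul, mul_comm]
  · have h := hg fun x => x ^ j
    rw [hmom j hj] at h
    linarith
  · rw [hg fun x => (1 - cos (π * n * x)) / (π * n), sum_congr rfl fun k _ => by rw [cosWave_grid hn k], htest,
      abs_mul, abs_neg, abs_pow, abs_neg, abs_one, one_pow, one_mul, abs_of_pos (by positivity)]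

/-! ## §4 In `ε`-language: not even an inverse-logarithmic price at law level -/

/-- **★★ THE LAW-LEVEL PRICE IS WORSE THAN `1∕log ε⁻¹`.**  For every window `0 < l₀`, every constant `C` and every `ε₀ > 0`: two probability laws
`μ, ν` on `[0, 1]` and `0 < ε ≤ ε₀` with cgf's `ε`-close on `|t| ≤ l₀`, together with a `1`-Lipschitz test function `g : ℝ → [0, 1]` paid
`|∫ g dν − ∫ g dμ| > C∕(1 + log⁺ ε⁻¹)`.  So NO estimate `dist_BL(μ, ν) ≤ C(l₀)∕(1 + log⁺ ε⁻¹)` — a fortiori no Hölder price `C(l₀)·ε^a` and no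
expectation-type price `C(l₀)·P(ε)` — follows from window matching of the cgf's, on the class of `[0,1]`-valued observables (§3 at `n ≍ L∕log L`:
the gap is `2∕(πn)` while `ε ≤ e^{−(2|C|+1)n}`). [folklore] -/
theorem law_price_not_inverse_log {l₀ : ℝ} (hl₀ : 0 < l₀) (C : ℝ) {ε₀ : ℝ} (hε₀ : 0 < ε₀) :
    ∃ μ ν : Measure ℝ, IsProbabilityMeasure μ ∧ IsProbabilityMeasure ν ∧
      μ (Set.Icc 0 1)ᶜ = 0 ∧ ν (Set.Icc 0 1)ᶜ = 0 ∧
      ∃ ε : ℝ, 0 < ε ∧ ε ≤ ε₀ ∧ (∀ t : ℝ, |t| ≤ l₀ → |cgf id ν t - cgf id μ t| ≤ ε) ∧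
        ∃ g : ℝ → ℝ, LipschitzWith 1 g ∧ (∀ x, 0 ≤ g x ∧ g x ≤ 1) ∧
          C / (1 + Real.posLog ε⁻¹) < |∫ x, g x ∂ν - ∫ x, g x ∂μ| := by
  set a : ℝ := l₀ * exp l₀ / 2 with ha
  have ha0 : 0 < a := by positivity
  set D : ℝ := 2 * |C| + 1 with hD
  have hD1 : 1 ≤ D := by have := abs_nonneg C; linarith
  have hD0 : 0 < D := one_pos.trans_le hD1
  obtain ⟨n, hn⟩ := exists_nat_gt (max (max (2 * a * exp D) (2 * exp l₀)) (-Real.log ε₀))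
  have hna : 2 * a * exp D < n := ((le_max_left _ _).trans (le_max_left _ _)).trans_lt hn
  have hne : 2 * exp l₀ < n := ((le_max_right _ _).trans (le_max_left _ _)).trans_lt hn
  have hnε : -Real.log ε₀ < n := (le_max_right _ _).trans_lt hn
  have hnr : (0 : ℝ) < n := lt_trans (by positivity) hne
  have hn0 : 0 < n := by exact_mod_cast hnr
  have hn1 : (1 : ℝ) ≤ n := by exact_mod_cast hn0
  obtain ⟨μ, ν, iμ, iν, hμ, hν, ε, hε, -, hhi, -, -, hcgf, -, htest⟩ := exists_cgf_close_laws_far hl₀ hn0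
  -- the cgf-closeness parameter `ε' = e^{l₀}ε ≤ e^{−Dn}`
  have hpow2 : (n : ℝ) ≤ 2 ^ n := by exact_mod_cast Nat.lt_two_pow_self.le
  have hkey : exp l₀ * ε ≤ exp (-(D * n)) := by
    have h1 : a / n ≤ exp (-D) / 2 := by
      rw [div_le_div_iff₀ hnr two_pos]
      calc a * 2 = 2 * a * exp D * exp (-D) := by
            rw [mul_assoc (2 * a), ← Real.exp_add, add_neg_cancel, Real.exp_zero, mul_one, mul_comm]
        _ ≤ n * exp (-D) := mul_le_mul_of_nonneg_right hna.le (exp_pos _).le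
        _ = exp (-D) * n := mul_comm _ _
    have h2 : (a / n) ^ n ≤ (exp (-D) / 2) ^ n := pow_le_pow_left₀ (by positivity) h1 n
    have h3 : (exp (-D) / 2) ^ n = exp (-(D * n)) / 2 ^ n := by
      rw [div_pow, ← Real.exp_nat_mul]
      ring_nf
    calc exp l₀ * ε ≤ exp l₀ * (2 * (a / n) ^ n) := by
          refine mul_le_mul_of_nonneg_left ?_ (exp_pos _).le
          rwa [ha, show l₀ * exp l₀ / 2 / (n : ℝ) = l₀ * exp l₀ / (2 * n) by rw [div_div]]
      _ ≤ exp l₀ * (2 * (exp (-(D * n)) / 2 ^ n)) := by gcongr; rwa [← h3]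
      _ = exp (-(D * n)) * (2 * exp l₀ / 2 ^ n) := by ring
      _ ≤ exp (-(D * n)) * 1 := by
          refine mul_le_mul_of_nonneg_left ?_ (exp_pos _).le
          rw [div_le_one (by positivity)]
          exact hne.le.trans hpow2
      _ = exp (-(D * n)) := mul_one _
  have hε' : 0 < exp l₀ * ε := by positivity
  refine ⟨μ, ν, iμ, iν, hμ, hν, exp l₀ * ε, hε', ?_, hcgf, fun x => (1 - cos (π * n * x)) / (π * n),
    lipschitzWith_one_cosWave hn0, fun x => ⟨cosWave_nonneg n x, (cosWave_le n x).trans ?_⟩, ?_⟩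
  · -- `ε' ≤ ε₀`
    refine hkey.trans ?_
    rw [← Real.le_log_iff_exp_le hε₀]
    have : (n : ℝ) ≤ D * n := le_mul_of_one_le_left hnr.le hD1
    linarith
  · -- `2∕(πn) ≤ 1`
    rw [div_le_one (by positivity)]
    nlinarith [Real.pi_gt_three]
  · -- `C∕(1 + L) < 2∕(πn)`
    rw [htest]
    have hL : D * n ≤ Real.posLog (exp l₀ * ε)⁻¹ := by
      have h1 : D * n ≤ Real.log (exp l₀ * ε)⁻¹ := by
        rw [Real.log_inv, le_neg, ← Real.log_exp (-(D * n))]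
        exact Real.log_le_log hε' hkey
      exact h1.trans (le_max_right 0 (Real.log (exp l₀ * ε)⁻¹))
    have hpos : 0 < 1 + Real.posLog (exp l₀ * ε)⁻¹ := by
      have := Real.posLog_nonneg (x := (exp l₀ * ε)⁻¹); linarith
    have hgap : 0 < 2 / (π * n) := by positivity
    rcases le_or_gt C 0 with hC | hC
    · exact lt_of_le_of_lt (div_nonpos_of_nonpos_of_nonneg hC hpos.le) hgap
    · rw [div_lt_div_iff₀ hpos (by positivity)]
      have habs : |C| = C := abs_of_pos hC
      have h1 : C * (π * n) < C * (4 * n) := by nlinarith [mul_pos hC hnr, Real.pi_lt_four]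
      have h2 : D * n = 2 * C * n + n := by rw [hD, habs]; ring
      linarith [hL, h1, h2, hnr, hC]

end Summit.QuantumFields.YangMills.Theorems.BalabanUVNodesN19LawPrice

end
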